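import Literature.MathematicalPhysics.KineticTheory.DuhamelSliceFormula
import Literature.NumberTheory.LFunctions.XiHeatRayGaussian
import HarnessLib

/-!
# Duhamel formulas along free transport: time regularity, positivity, differences

Topic: MathematicalPhysics / KineticTheory. Third part of the slice-wise theory of the Duhamel
formula `U(t, z) = f₀(A_t z) e^{-∫₀ᵗ Λ} + ∫₀ᵗ e^{-∫ₛᵗ Λ} Γ_s(A_{t-s} z) ds` of
`DuhamelSliceBounds` / `DuhamelSliceFormula` (infrastructure for CIP 1994 §5.3 Lemma 5.3.6):

* `duhamel_hasDerivWithinAt_characteristic` (**the equation along characteristics**): for every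
  `x₀, v` and `σ ∈ [0, T]`, `σ ↦ U(σ, x₀ + σ v, v)` has, within `[0, T]`, the derivative
  `Γ_σ - Λ_σ U(σ, ·)` at `(x₀ + σ v, v)` (the scalar ODE along the characteristic, as in
  `TransportDuhamel.duhamel_transport_eq`, here with data only continuous in time);
* `duhamel_continuousOn_time`: `t ↦ U(t, z)` is continuous on `[0, T]` for every `z`
  (slice-Lipschitz bounds plus continuity along characteristics);
* `duhamel_lower_bound'`: `U(t, z) ≥ f₀(A_t z) e^{-C₀ t}` when `f₀, Γ ≥ 0` and `Λ ≤ C₀`;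
* `duhamel_weighted_diff` (**the contraction estimate**): for two data `(Λ, Γ)`, `(Λ', Γ')` with
  the same `f₀`, `(1 + ‖z‖)ᴷ |U(t,z) - U'(t,z)| ≤ (1 + T)ᴷ ((Φ + Γ'_K T) ∫₀ᵗ dΛ + ∫₀ᵗ dΓ)` for
  continuous majorants `|Λ_s - Λ'_s| ≤ dΛ(s)`, `(1 + ‖y‖)ᴷ |Γ_s(y) - Γ'_s(y)| ≤ dΓ(s)`.

Everything is proved; theorems only.

## References

* C. Cercignani, R. Illner, M. Pulvirenti, *The Mathematical Theory of Dilute Gases*, Springer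
  (1994), §5.3 Lemma 5.3.6, pp. 145–146 (the iteration and its convergence in `C([0,T]; L¹)`).
-/

noncomputable section

open MeasureTheory Set Filter Function Metric intervalIntegral
open scoped ContDiff Topology

namespace Literature.MathematicalPhysics.KineticTheory

open Literature.Analysis.Calculus

variable {E : Type*} [NormedAddCommGroup E] [NormedSpace ℝ E] [FiniteDimensional ℝ E]

section Time

variable {T : ℝ} {f₀ : E × E → ℝ} {L G U : ℝ → E × E → ℝ}

omit [FiniteDimensional ℝ E] in
/-- Restriction to a characteristic of a family of slices which is jointly continuous on
`[0, T] × (E × E)`: `s ↦ L s (x₀ + s v, v)` is continuous on `[0, T]`, and its clamped version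
`s ↦ L (clamp s) (x₀ + clamp s v, v)` is continuous on `ℝ`. [folklore] -/
theorem continuous_family_characteristic_clamp (hT : 0 ≤ T) (hL : ∀ σ, ContDiff ℝ ∞ (L σ))
    (hLc : ∀ y, ContinuousOn (fun σ => L σ y) (Icc 0 T))
    (hLb : ∀ n : ℕ, ∃ C : ℝ, ∀ σ ∈ Icc (0:ℝ) T, ∀ y, ‖iteratedFDeriv ℝ n (L σ) y‖ ≤ C) (x₀ v : E) :
    Continuous fun s : ℝ => L (max 0 (min s T)) (x₀ + max 0 (min s T) • v, v) := by
  have hjoint := continuousOn_uncurry_family hL hLc hLb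
  have hc := continuous_clamp 0 T
  have hγ : Continuous fun s : ℝ => ((max 0 (min s T), (x₀ + max 0 (min s T) • v, v)) : ℝ × (E × E)) :=
    hc.prodMk ((continuous_const.add (hc.smul continuous_const)).prodMk continuous_const)
  exact hjoint.comp_continuous hγ fun s => ⟨clamp_mem hT s, mem_univ _⟩

omit [FiniteDimensional ℝ E] in
/-- **The Duhamel formula solves the transport equation along characteristics** (data
continuous in time): for `x₀, v ∈ E` and `σ ∈ [0, T]`, `σ ↦ U(σ, x₀ + σ v, v)` has within
`[0, T]` the derivative `Γ_σ(y) - Λ_σ(y) U(σ, y)` at `y = (x₀ + σ v, v)`. [folklore] -/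
theorem duhamel_hasDerivWithinAt_characteristic (hT : 0 ≤ T) (hL : ∀ σ, ContDiff ℝ ∞ (L σ))
    (hLc : ∀ y, ContinuousOn (fun σ => L σ y) (Icc 0 T))
    (hLb : ∀ n : ℕ, ∃ C : ℝ, ∀ σ ∈ Icc (0:ℝ) T, ∀ y, ‖iteratedFDeriv ℝ n (L σ) y‖ ≤ C)
    (hG : ∀ s, ContDiff ℝ ∞ (G s)) (hGc : ∀ y, ContinuousOn (fun s => G s y) (Icc 0 T))
    (hGb : ∀ n : ℕ, ∃ C : ℝ, ∀ s ∈ Icc (0:ℝ) T, ∀ y, ‖iteratedFDeriv ℝ n (G s) y‖ ≤ C)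
    (hU : ∀ t ∈ Icc (0:ℝ) T, ∀ z : E × E, U t z =
      f₀ (z.1 - t • z.2, z.2) * Real.exp (-(∫ σ in (0:ℝ)..t, L σ (z.1 - (t - σ) • z.2, z.2))) +
        ∫ s in (0:ℝ)..t, Real.exp (-(∫ σ in s..t, L σ (z.1 - (t - σ) • z.2, z.2))) *
          G s (z.1 - (t - s) • z.2, z.2))
    (x₀ v : E) {σ : ℝ} (hσ : σ ∈ Icc (0:ℝ) T) :
    HasDerivWithinAt (fun s => U s (x₀ + s • v, v))
      (G σ (x₀ + σ • v, v) - L σ (x₀ + σ • v, v) * U σ (x₀ + σ • v, v)) (Icc 0 T) σ := by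
  -- the clamped data along the characteristic, continuous on `ℝ`
  set c : ℝ → ℝ := fun s => max 0 (min s T) with hc
  have hcI : ∀ s ∈ Icc (0:ℝ) T, c s = s := fun s hs => clamp_eq_self hs
  set lam : ℝ → ℝ := fun s => L (c s) (x₀ + c s • v, v) with hlam
  set gam : ℝ → ℝ := fun s => G (c s) (x₀ + c s • v, v) with hgam
  have hlc : Continuous lam := continuous_family_characteristic_clamp hT hL hLc hLb x₀ v
  have hgc : Continuous gam := continuous_family_characteristic_clamp hT hG hGc hGb x₀ v
  -- the primitive `a` and the explicit solution `ψ`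
  set a : ℝ → ℝ := fun τ => ∫ s in (0:ℝ)..τ, lam s with ha
  have ha_deriv : ∀ τ, HasDerivAt a (lam τ) τ := fun τ =>
    integral_hasDerivAt_right (hlc.intervalIntegrable _ _)
      hlc.aestronglyMeasurable.stronglyMeasurableAtFilter hlc.continuousAt
  have hac : Continuous a := continuous_iff_continuousAt.2 fun τ => (ha_deriv τ).continuousAt
  set ψ : ℝ → ℝ := fun τ => Real.exp (-a τ) * (f₀ (x₀, v) + ∫ s in (0:ℝ)..τ, Real.exp (a s) * gam s) with hψ
  have hψ_deriv : ∀ τ, HasDerivAt ψ (-lam τ * ψ τ + gam τ) τ := by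
    intro τ
    have hF : HasDerivAt (fun τ => ∫ s in (0:ℝ)..τ, Real.exp (a s) * gam s) (Real.exp (a τ) * gam τ) τ := by
      have hc' : Continuous fun s => Real.exp (a s) * gam s := (Real.continuous_exp.comp hac).mul hgc
      exact integral_hasDerivAt_right (hc'.intervalIntegrable _ _)
        hc'.aestronglyMeasurable.stronglyMeasurableAtFilter hc'.continuousAt
    have hE : HasDerivAt (fun τ => Real.exp (-a τ)) (Real.exp (-a τ) * (-lam τ)) τ := (ha_deriv τ).neg.exp
    have h := hE.mul (hF.const_add (f₀ (x₀, v)))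
    refine h.congr_deriv ?_
    have hee : Real.exp (-a τ) * Real.exp (a τ) = 1 := by rw [← Real.exp_add, neg_add_cancel, Real.exp_zero]
    simp only [hψ]
    calc Real.exp (-a τ) * -lam τ * (f₀ (x₀, v) + ∫ s in (0:ℝ)..τ, Real.exp (a s) * gam s) +
          Real.exp (-a τ) * (Real.exp (a τ) * gam τ)
        = -lam τ * (Real.exp (-a τ) * (f₀ (x₀, v) + ∫ s in (0:ℝ)..τ, Real.exp (a s) * gam s)) +
            (Real.exp (-a τ) * Real.exp (a τ)) * gam τ := by ring
      _ = _ := by rw [hee, one_mul]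
  -- `ψ = U` along the characteristic on `[0, T]`
  have hinner : ∀ τ ∈ Icc (0:ℝ) T, ∀ s ∈ Icc (0:ℝ) τ,
      ∫ σ' in s..τ, L σ' (x₀ + τ • v - (τ - σ') • v, v) = a τ - a s := by
    intro τ hτ s hs
    have hJ : ∫ σ' in s..τ, lam σ' = a τ - a s :=
      (integral_interval_sub_left (hlc.intervalIntegrable _ _) (hlc.intervalIntegrable _ _)).symm
    rw [← hJ]
    refine integral_congr fun σ' hσ' => ?_
    rw [uIcc_of_le hs.2] at hσ'
    have hσ'T : σ' ∈ Icc (0:ℝ) T := ⟨hs.1.trans hσ'.1, hσ'.2.trans hτ.2⟩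
    simp only [hlam, hcI σ' hσ'T]
    congr 1
    rw [sub_smul]; abel_nf
  have hψU : ∀ τ ∈ Icc (0:ℝ) T, U τ (x₀ + τ • v, v) = ψ τ := by
    intro τ hτ
    rw [hU τ hτ]
    have e1 : x₀ + τ • v - τ • v = x₀ := add_sub_cancel_right _ _
    simp only [e1]
    have h0 : ∫ σ' in (0:ℝ)..τ, L σ' (x₀ + τ • v - (τ - σ') • v, v) = a τ := by
      rw [hinner τ hτ 0 ⟨le_rfl, hτ.1⟩]
      simp [ha]
    rw [h0, hψ]
    simp only
    rw [mul_add, mul_comm (Real.exp _) (f₀ _), ← intervalIntegral.integral_const_mul]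
    congr 1
    refine integral_congr fun s hs => ?_
    rw [uIcc_of_le hτ.1] at hs
    have hsT : s ∈ Icc (0:ℝ) T := ⟨hs.1, hs.2.trans hτ.2⟩
    rw [hinner τ hτ s hs]
    have e2 : x₀ + τ • v - (τ - s) • v = x₀ + s • v := by rw [sub_smul]; abel
    simp only [e2, hgam, hcI s hsT]
    rw [← mul_assoc, ← Real.exp_add]
    congr 2
    ring
  -- conclude
  have hmain := (hψ_deriv σ).hasDerivWithinAt (s := Icc 0 T)
  have heq : EqOn (fun s => U s (x₀ + s • v, v)) ψ (Icc 0 T) := fun s hs => hψU s hs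
  refine (hmain.congr heq (heq hσ)).congr_deriv ?_
  rw [← hψU σ hσ]
  simp only [hlam, hgam, hcI σ hσ]
  ring

/-- **Continuity in time of the Duhamel formula**, pointwise in the slice variable: `t ↦ U(t, z)`
is continuous on `[0, T]` (slice-Lipschitz bounds, uniform on `[0, T]`, and continuity along the
characteristic through `(t, z)`). [folklore] -/
theorem duhamel_continuousOn_time (hf₀ : ContDiff ℝ ∞ f₀)
    (hL : ∀ σ, ContDiff ℝ ∞ (L σ)) (hLc : ∀ y, ContinuousOn (fun σ => L σ y) (Icc 0 T))
    (hLb : ∀ n : ℕ, ∃ C : ℝ, ∀ σ ∈ Icc (0:ℝ) T, ∀ y, ‖iteratedFDeriv ℝ n (L σ) y‖ ≤ C)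
    (hL0 : ∀ σ ∈ Icc (0:ℝ) T, ∀ y, 0 ≤ L σ y)
    (hG : ∀ s, ContDiff ℝ ∞ (G s)) (hGc : ∀ y, ContinuousOn (fun s => G s y) (Icc 0 T))
    (hGb : ∀ n k : ℕ, ∃ C : ℝ, ∀ s ∈ Icc (0:ℝ) T, ∀ y : E × E,
      (1 + ‖y‖) ^ k * ‖iteratedFDeriv ℝ n (G s) y‖ ≤ C)
    (hU : ∀ t ∈ Icc (0:ℝ) T, ∀ z : E × E, U t z =
      f₀ (z.1 - t • z.2, z.2) * Real.exp (-(∫ σ in (0:ℝ)..t, L σ (z.1 - (t - σ) • z.2, z.2))) +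
        ∫ s in (0:ℝ)..t, Real.exp (-(∫ σ in s..t, L σ (z.1 - (t - σ) • z.2, z.2))) *
          G s (z.1 - (t - s) • z.2, z.2))
    {M₁ : ℝ} (hM₁ : ∀ t ∈ Icc (0:ℝ) T, ∀ y : E × E, ‖iteratedFDeriv ℝ 1 (U t) y‖ ≤ M₁) (z : E × E) :
    ContinuousOn (fun t => U t z) (Icc 0 T) := by
  intro t ht
  have hT : 0 ≤ T := ht.1.trans ht.2
  have hM₁0 : 0 ≤ M₁ := (norm_nonneg _).trans (hM₁ t ht 0)
  -- continuity along the characteristic through `(t, z)`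
  set x₀ : E := z.1 - t • z.2 with hx₀
  have hchar : ContinuousWithinAt (fun s => U s (x₀ + s • z.2, z.2)) (Icc 0 T) t :=
    (duhamel_hasDerivWithinAt_characteristic hT hL hLc hLb hG hGc (family_unweighted_of_weighted hGb)
      hU x₀ z.2 ht).continuousWithinAt
  have hzt : x₀ + t • z.2 = z.1 := by rw [hx₀]; abel
  refine Metric.continuousWithinAt_iff.2 fun ε hε => ?_
  obtain ⟨δ₁, hδ₁, h₁⟩ := Metric.continuousWithinAt_iff.1 hchar (ε / 2) (half_pos hε)
  set δ : ℝ := min δ₁ (ε / (2 * (M₁ * ‖z.2‖ + 1))) with hδ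
  refine ⟨δ, lt_min hδ₁ (by positivity), fun t' ht' hd => ?_⟩
  have hd₁ : dist t' t < δ₁ := hd.trans_le (min_le_left _ _)
  have hd₂ : dist t' t < ε / (2 * (M₁ * ‖z.2‖ + 1)) := hd.trans_le (min_le_right _ _)
  have hA := h₁ ht' hd₁
  rw [hzt] at hA
  -- slice Lipschitz at time `t'`
  have hlip : ‖U t' z - U t' (x₀ + t' • z.2, z.2)‖ ≤ M₁ * ‖z - (x₀ + t' • z.2, z.2)‖ :=
    norm_sub_le_of_iteratedFDeriv_one_le (duhamel_slice_contDiff hf₀ hL hLc hLb hL0 hG hGc hGb hU ht')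
      (hM₁ t' ht') _ _
  have hdiff : ‖z - ((x₀ + t' • z.2, z.2) : E × E)‖ = |t' - t| * ‖z.2‖ := by
    have e : z - ((x₀ + t' • z.2, z.2) : E × E) = ((-(t' - t)) • z.2, 0) := by
      ext
      · simp only [Prod.fst_sub, hx₀, neg_smul, sub_smul]; abel
      · simp
    rw [e, Prod.norm_def, norm_smul, norm_neg, Real.norm_eq_abs, norm_zero, max_eq_left (by positivity)]
  rw [hdiff] at hlip
  rw [dist_eq_norm] at hA ⊢
  have hz : (fun s => U s z) t = U t (z.1, z.2) := by simp
  calc ‖U t' z - U t z‖ ≤ ‖U t' z - U t' (x₀ + t' • z.2, z.2)‖ + ‖U t' (x₀ + t' • z.2, z.2) - U t (z.1, z.2)‖ := by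
        have := norm_sub_le_norm_sub_add_norm_sub (U t' z) (U t' (x₀ + t' • z.2, z.2)) (U t (z.1, z.2))
        simpa using this
    _ ≤ M₁ * (|t' - t| * ‖z.2‖) + ε / 2 := add_le_add hlip hA.le
    _ < ε / 2 + ε / 2 := by
        refine add_lt_add_of_lt_of_le ?_ le_rfl
        rw [Real.dist_eq] at hd₂
        rw [lt_div_iff₀ (by positivity)] at hd₂
        nlinarith [abs_nonneg (t' - t), norm_nonneg z.2]
    _ = ε := by ring

/-- **Positivity of the Duhamel formula**: if `f₀ ≥ 0`, `Γ ≥ 0` on `[0, T]` and `Λ ≤ C₀` on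
`[0, T]`, then `U(t, z) ≥ f₀(A_t z) e^{-C₀ t}` on `[0, T]`. [folklore] -/
theorem duhamel_lower_bound' (hL : ∀ σ, ContDiff ℝ ∞ (L σ))
    (hLc : ∀ y, ContinuousOn (fun σ => L σ y) (Icc 0 T))
    (hLb : ∀ n : ℕ, ∃ C : ℝ, ∀ σ ∈ Icc (0:ℝ) T, ∀ y, ‖iteratedFDeriv ℝ n (L σ) y‖ ≤ C)
    {C₀ : ℝ} (hLC : ∀ σ ∈ Icc (0:ℝ) T, ∀ y, L σ y ≤ C₀)
    (hG0 : ∀ s ∈ Icc (0:ℝ) T, ∀ y, 0 ≤ G s y) (hf₀0 : ∀ y, 0 ≤ f₀ y)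
    (hU : ∀ t ∈ Icc (0:ℝ) T, ∀ z : E × E, U t z =
      f₀ (z.1 - t • z.2, z.2) * Real.exp (-(∫ σ in (0:ℝ)..t, L σ (z.1 - (t - σ) • z.2, z.2))) +
        ∫ s in (0:ℝ)..t, Real.exp (-(∫ σ in s..t, L σ (z.1 - (t - σ) • z.2, z.2))) *
          G s (z.1 - (t - s) • z.2, z.2))
    {t : ℝ} (ht : t ∈ Icc (0:ℝ) T) (z : E × E) :
    f₀ (z.1 - t • z.2, z.2) * Real.exp (-(C₀ * t)) ≤ U t z := by
  rw [hU t ht z]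
  have h1 : Real.exp (-(C₀ * t)) ≤ Real.exp (-(∫ σ in (0:ℝ)..t, L σ (z.1 - (t - σ) • z.2, z.2))) := by
    refine Real.exp_le_exp.2 (neg_le_neg ?_)
    have := absorptionIntegral_le hL hLc hLb hLC le_rfl ht.1 ht.2 z
    rwa [sub_zero] at this
  have h2 : 0 ≤ ∫ s in (0:ℝ)..t, Real.exp (-(∫ σ in s..t, L σ (z.1 - (t - σ) • z.2, z.2))) *
      G s (z.1 - (t - s) • z.2, z.2) :=
    integral_nonneg ht.1 fun s hs => mul_nonneg (Real.exp_pos _).le (hG0 s ⟨hs.1, hs.2.trans ht.2⟩ _)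
  nlinarith [hf₀0 (z.1 - t • z.2, z.2), mul_le_mul_of_nonneg_left h1 (hf₀0 (z.1 - t • z.2, z.2))]

/-- **The contraction estimate** (weighted differences at level zero): let `(Λ, Γ, U)` and
`(Λ', Γ', U')` be two admissible data with the same `f₀`, `(1 + ‖y‖)ᴷ |f₀(y)| ≤ Φ`,
`(1 + ‖y‖)ᴷ |Γ'_s(y)| ≤ Γ'_K` on `[0, T]`, and continuous majorants `|Λ_s(y) - Λ'_s(y)| ≤ dΛ(s)`,
`(1 + ‖y‖)ᴷ |Γ_s(y) - Γ'_s(y)| ≤ dΓ(s)` on `[0, T]`. Then on `[0, T]`,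
`(1 + ‖z‖)ᴷ |U(t,z) - U'(t,z)| ≤ (1 + T)ᴷ ((Φ + Γ'_K T) ∫₀ᵗ dΛ + ∫₀ᵗ dΓ)` (CIP 1994 (3.20) and
the convergence of the iteration in `C([0,T]; L¹)`, here in weighted sup norms). [cite: CIPDiluteGases1994, §5.3 Lemma 5.3.6 (3.20)] -/
theorem duhamel_weighted_diff {L' G' U' : ℝ → E × E → ℝ} (hL : ∀ σ, ContDiff ℝ ∞ (L σ))
    (hLc : ∀ y, ContinuousOn (fun σ => L σ y) (Icc 0 T))
    (hLb : ∀ n : ℕ, ∃ C : ℝ, ∀ σ ∈ Icc (0:ℝ) T, ∀ y, ‖iteratedFDeriv ℝ n (L σ) y‖ ≤ C)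
    (hL0 : ∀ σ ∈ Icc (0:ℝ) T, ∀ y, 0 ≤ L σ y)
    (hG : ∀ s, ContDiff ℝ ∞ (G s)) (hGc : ∀ y, ContinuousOn (fun s => G s y) (Icc 0 T))
    (hGb : ∀ n k : ℕ, ∃ C : ℝ, ∀ s ∈ Icc (0:ℝ) T, ∀ y : E × E,
      (1 + ‖y‖) ^ k * ‖iteratedFDeriv ℝ n (G s) y‖ ≤ C)
    (hU : ∀ t ∈ Icc (0:ℝ) T, ∀ z : E × E, U t z =
      f₀ (z.1 - t • z.2, z.2) * Real.exp (-(∫ σ in (0:ℝ)..t, L σ (z.1 - (t - σ) • z.2, z.2))) +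
        ∫ s in (0:ℝ)..t, Real.exp (-(∫ σ in s..t, L σ (z.1 - (t - σ) • z.2, z.2))) *
          G s (z.1 - (t - s) • z.2, z.2))
    (hL' : ∀ σ, ContDiff ℝ ∞ (L' σ)) (hL'c : ∀ y, ContinuousOn (fun σ => L' σ y) (Icc 0 T))
    (hL'b : ∀ n : ℕ, ∃ C : ℝ, ∀ σ ∈ Icc (0:ℝ) T, ∀ y, ‖iteratedFDeriv ℝ n (L' σ) y‖ ≤ C)
    (hL'0 : ∀ σ ∈ Icc (0:ℝ) T, ∀ y, 0 ≤ L' σ y)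
    (hG' : ∀ s, ContDiff ℝ ∞ (G' s)) (hG'c : ∀ y, ContinuousOn (fun s => G' s y) (Icc 0 T))
    (hG'b : ∀ n k : ℕ, ∃ C : ℝ, ∀ s ∈ Icc (0:ℝ) T, ∀ y : E × E,
      (1 + ‖y‖) ^ k * ‖iteratedFDeriv ℝ n (G' s) y‖ ≤ C)
    (hU' : ∀ t ∈ Icc (0:ℝ) T, ∀ z : E × E, U' t z =
      f₀ (z.1 - t • z.2, z.2) * Real.exp (-(∫ σ in (0:ℝ)..t, L' σ (z.1 - (t - σ) • z.2, z.2))) +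
        ∫ s in (0:ℝ)..t, Real.exp (-(∫ σ in s..t, L' σ (z.1 - (t - σ) • z.2, z.2))) *
          G' s (z.1 - (t - s) • z.2, z.2))
    {K : ℕ} {Φ Γ'K : ℝ} (hΦ : ∀ y : E × E, (1 + ‖y‖) ^ K * |f₀ y| ≤ Φ)
    (hΓ'K : ∀ s ∈ Icc (0:ℝ) T, ∀ y : E × E, (1 + ‖y‖) ^ K * |G' s y| ≤ Γ'K)
    {dL dG : ℝ → ℝ} (hdLc : ContinuousOn dL (Icc 0 T)) (hdGc : ContinuousOn dG (Icc 0 T))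
    (hdL : ∀ s ∈ Icc (0:ℝ) T, ∀ y, |L s y - L' s y| ≤ dL s)
    (hdG : ∀ s ∈ Icc (0:ℝ) T, ∀ y : E × E, (1 + ‖y‖) ^ K * |G s y - G' s y| ≤ dG s)
    {t : ℝ} (ht : t ∈ Icc (0:ℝ) T) (z : E × E) :
    (1 + ‖z‖) ^ K * |U t z - U' t z| ≤
      (1 + T) ^ K * ((Φ + Γ'K * T) * (∫ s in (0:ℝ)..t, dL s) + ∫ s in (0:ℝ)..t, dG s) := by
  have hT : 0 ≤ T := ht.1.trans ht.2
  have hw0 : 0 < (1 + ‖z‖) ^ K := by positivity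
  have hΦ0 : 0 ≤ Φ := le_trans (by positivity) (hΦ 0)
  have hΓ0 : 0 ≤ Γ'K := le_trans (by positivity) (hΓ'K t ht 0)
  have hdL0 : ∀ s ∈ Icc (0:ℝ) T, 0 ≤ dL s := fun s hs => (abs_nonneg _).trans (hdL s hs 0)
  have hdG0 : ∀ s ∈ Icc (0:ℝ) T, 0 ≤ dG s := fun s hs => le_trans (by positivity) (hdG s hs 0)
  have hdLi : IntervalIntegrable dL volume 0 t := (hdLc.mono (Icc_subset_Icc le_rfl ht.2)).intervalIntegrable_of_Icc ht.1
  have hdGi : IntervalIntegrable dG volume 0 t := (hdGc.mono (Icc_subset_Icc le_rfl ht.2)).intervalIntegrable_of_Icc ht.1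
  set DL : ℝ := ∫ s in (0:ℝ)..t, dL s with hDL
  have hDL0 : 0 ≤ DL := integral_nonneg ht.1 fun s hs => hdL0 s ⟨hs.1, hs.2.trans ht.2⟩
  -- the families along characteristics at `z`, their absorption integrals
  obtain ⟨-, -, hL3⟩ := shearFamily_props hL hLc hLb ht
  obtain ⟨-, -, hL'3⟩ := shearFamily_props hL' hL'c hL'b ht
  have hcont : ∀ {M : ℝ → E × E → ℝ}, (∀ (n : ℕ) (z : E × E), ContinuousOn
      (fun σ => iteratedFDeriv ℝ n (fun z : E × E => M σ (z.1 - (t - σ) • z.2, z.2)) z) (Icc 0 T)) →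
      ContinuousOn (fun σ => M σ (z.1 - (t - σ) • z.2, z.2)) (Icc 0 T) := by
    intro M h3
    have := h3 0 z
    have e : (fun σ => M σ (z.1 - (t - σ) • z.2, z.2)) =
        fun σ => (iteratedFDeriv ℝ 0 (fun z : E × E => M σ (z.1 - (t - σ) • z.2, z.2)) z) 0 := rfl
    rw [e]
    exact (continuous_eval_const (0 : Fin 0 → E × E)).comp_continuousOn this
  have hLz := hcont hL3
  have hL'z := hcont hL'3
  set J : ℝ → ℝ := fun s => ∫ σ in s..t, L σ (z.1 - (t - σ) • z.2, z.2) with hJdef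
  set J' : ℝ → ℝ := fun s => ∫ σ in s..t, L' σ (z.1 - (t - σ) • z.2, z.2) with hJ'def
  have hJdiff : ∀ s ∈ Icc (0:ℝ) t, |Real.exp (-J s) - Real.exp (-J' s)| ≤ DL := by
    intro s hs
    have hJ0 : 0 ≤ J s := absorptionIntegral_nonneg hL0 hs.1 hs.2 ht.2 z
    have hJ'0 : 0 ≤ J' s := absorptionIntegral_nonneg hL'0 hs.1 hs.2 ht.2 z
    refine (Literature.NumberTheory.LFunctions.abs_exp_neg_sub_exp_neg_le hJ0 hJ'0).trans ?_
    have hsub : J s - J' s = ∫ σ in s..t, (L σ (z.1 - (t - σ) • z.2, z.2) - L' σ (z.1 - (t - σ) • z.2, z.2)) := by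
      simp only [hJdef, hJ'def]
      rw [integral_sub ((hLz.mono (Icc_subset_Icc hs.1 ht.2)).intervalIntegrable_of_Icc hs.2)
        ((hL'z.mono (Icc_subset_Icc hs.1 ht.2)).intervalIntegrable_of_Icc hs.2)]
    rw [hsub]
    calc |∫ σ in s..t, (L σ (z.1 - (t - σ) • z.2, z.2) - L' σ (z.1 - (t - σ) • z.2, z.2))|
        ≤ ∫ σ in s..t, |L σ (z.1 - (t - σ) • z.2, z.2) - L' σ (z.1 - (t - σ) • z.2, z.2)| :=
          abs_integral_le_integral_abs hs.2
      _ ≤ ∫ σ in s..t, dL σ := by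
          refine integral_mono_on hs.2 ?_ ((hdLc.mono (Icc_subset_Icc hs.1 ht.2)).intervalIntegrable_of_Icc hs.2)
            fun σ hσ => hdL σ ⟨hs.1.trans hσ.1, hσ.2.trans ht.2⟩ _
          exact (((hLz.sub hL'z).mono (Icc_subset_Icc hs.1 ht.2)).intervalIntegrable_of_Icc hs.2).abs
      _ ≤ DL := integral_mono_interval hs.1 hs.2 le_rfl
          ((ae_restrict_mem measurableSet_Ioc).mono fun σ hσ => hdL0 σ ⟨hσ.1.le, hσ.2.trans ht.2⟩) hdLi
  -- weight transfer
  have hwt : ∀ s ∈ Icc (0:ℝ) t, (1 + ‖z‖) ^ K ≤ (1 + T) ^ K * (1 + ‖((z.1 - (t - s) • z.2, z.2) : E × E)‖) ^ K :=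
    fun s hs => weight_le_shift z.1 z.2 (abs_le.2 ⟨by linarith [hs.2, ht.1], by linarith [hs.1, ht.2]⟩) K
  -- (1) the head
  have h1 : (1 + ‖z‖) ^ K * |f₀ (z.1 - t • z.2, z.2) * Real.exp (-J 0) - f₀ (z.1 - t • z.2, z.2) * Real.exp (-J' 0)| ≤
      (1 + T) ^ K * Φ * DL := by
    rw [← mul_sub, abs_mul]
    have hw := hwt 0 ⟨le_rfl, ht.1⟩
    rw [sub_zero] at hw
    calc (1 + ‖z‖) ^ K * (|f₀ (z.1 - t • z.2, z.2)| * |Real.exp (-J 0) - Real.exp (-J' 0)|)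
        ≤ ((1 + T) ^ K * (1 + ‖((z.1 - t • z.2, z.2) : E × E)‖) ^ K) * (|f₀ (z.1 - t • z.2, z.2)| * DL) :=
          mul_le_mul hw (mul_le_mul_of_nonneg_left (hJdiff 0 ⟨le_rfl, ht.1⟩) (abs_nonneg _))
            (by positivity) (by positivity)
      _ = (1 + T) ^ K * ((1 + ‖((z.1 - t • z.2, z.2) : E × E)‖) ^ K * |f₀ (z.1 - t • z.2, z.2)|) * DL := by ring
      _ ≤ (1 + T) ^ K * Φ * DL := by gcongr; exact hΦ _
  -- (2) the integrands, pointwise in `s`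
  have h2 : ∀ s ∈ Icc (0:ℝ) t, (1 + ‖z‖) ^ K *
      |Real.exp (-J s) * G s (z.1 - (t - s) • z.2, z.2) - Real.exp (-J' s) * G' s (z.1 - (t - s) • z.2, z.2)| ≤
      (1 + T) ^ K * (dG s + DL * Γ'K) := by
    intro s hs
    have hsT : s ∈ Icc (0:ℝ) T := ⟨hs.1, hs.2.trans ht.2⟩
    have hE : Real.exp (-J s) ≤ 1 := Real.exp_le_one_iff.2 (neg_nonpos.2 (absorptionIntegral_nonneg hL0 hs.1 hs.2 ht.2 z))
    set y : E × E := (z.1 - (t - s) • z.2, z.2) with hy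
    have hsplit : Real.exp (-J s) * G s y - Real.exp (-J' s) * G' s y =
        Real.exp (-J s) * (G s y - G' s y) + (Real.exp (-J s) - Real.exp (-J' s)) * G' s y := by ring
    rw [hsplit]
    calc (1 + ‖z‖) ^ K * |Real.exp (-J s) * (G s y - G' s y) + (Real.exp (-J s) - Real.exp (-J' s)) * G' s y|
        ≤ (1 + ‖z‖) ^ K * (1 * |G s y - G' s y| + DL * |G' s y|) := by
          refine mul_le_mul_of_nonneg_left ((abs_add_le _ _).trans (add_le_add ?_ ?_)) hw0.le
          · rw [abs_mul, abs_of_pos (Real.exp_pos _)]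
            exact mul_le_mul_of_nonneg_right hE (abs_nonneg _)
          · rw [abs_mul]
            exact mul_le_mul_of_nonneg_right (hJdiff s hs) (abs_nonneg _)
      _ = (1 + ‖z‖) ^ K * |G s y - G' s y| + DL * ((1 + ‖z‖) ^ K * |G' s y|) := by ring
      _ ≤ (1 + T) ^ K * ((1 + ‖y‖) ^ K * |G s y - G' s y|) + DL * ((1 + T) ^ K * ((1 + ‖y‖) ^ K * |G' s y|)) := by
          refine add_le_add ?_ (mul_le_mul_of_nonneg_left ?_ hDL0)
          · rw [← mul_assoc]; exact mul_le_mul_of_nonneg_right (hwt s hs) (abs_nonneg _)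
          · rw [← mul_assoc]; exact mul_le_mul_of_nonneg_right (hwt s hs) (abs_nonneg _)
      _ ≤ (1 + T) ^ K * dG s + DL * ((1 + T) ^ K * Γ'K) :=
          add_le_add (mul_le_mul_of_nonneg_left (hdG s hsT y) (by positivity))
            (mul_le_mul_of_nonneg_left (mul_le_mul_of_nonneg_left (hΓ'K s hsT y) (by positivity)) hDL0)
      _ = (1 + T) ^ K * (dG s + DL * Γ'K) := by ring
  -- integrability / continuity of the two integrands in `s`
  obtain ⟨-, -, hK3⟩ := duhamelIntegrand_family hL hLc hLb hL0 hG hGc hGb ht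
  obtain ⟨-, -, hK'3⟩ := duhamelIntegrand_family hL' hL'c hL'b hL'0 hG' hG'c hG'b ht
  have hKc : ∀ {M N : ℝ → E × E → ℝ}, (∀ (n : ℕ) (z : E × E), ContinuousOn (fun s =>
      iteratedFDeriv ℝ n (fun z : E × E => Real.exp (-(∫ σ in s..t, M σ (z.1 - (t - σ) • z.2, z.2))) *
        N s (z.1 - (t - s) • z.2, z.2)) z) (Icc 0 t)) →
      ContinuousOn (fun s => Real.exp (-(∫ σ in s..t, M σ (z.1 - (t - σ) • z.2, z.2))) *
        N s (z.1 - (t - s) • z.2, z.2)) (Icc 0 t) := by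
    intro M N h3
    have := h3 0 z
    have e : (fun s => Real.exp (-(∫ σ in s..t, M σ (z.1 - (t - σ) • z.2, z.2))) *
        N s (z.1 - (t - s) • z.2, z.2)) = fun s => (iteratedFDeriv ℝ 0 (fun z : E × E =>
          Real.exp (-(∫ σ in s..t, M σ (z.1 - (t - σ) • z.2, z.2))) * N s (z.1 - (t - s) • z.2, z.2)) z) 0 := rfl
    rw [e]
    exact (continuous_eval_const (0 : Fin 0 → E × E)).comp_continuousOn this
  have hc1 := hKc hK3
  have hc2 := hKc hK'3
  have hI : (1 + ‖z‖) ^ K * |(∫ s in (0:ℝ)..t, Real.exp (-J s) * G s (z.1 - (t - s) • z.2, z.2)) -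
      ∫ s in (0:ℝ)..t, Real.exp (-J' s) * G' s (z.1 - (t - s) • z.2, z.2)| ≤
      (1 + T) ^ K * ((∫ s in (0:ℝ)..t, dG s) + DL * Γ'K * t) := by
    rw [← integral_sub (hc1.intervalIntegrable_of_Icc ht.1) (hc2.intervalIntegrable_of_Icc ht.1)]
    calc (1 + ‖z‖) ^ K * |∫ s in (0:ℝ)..t, (Real.exp (-J s) * G s (z.1 - (t - s) • z.2, z.2) -
          Real.exp (-J' s) * G' s (z.1 - (t - s) • z.2, z.2))|
        ≤ (1 + ‖z‖) ^ K * ∫ s in (0:ℝ)..t, |Real.exp (-J s) * G s (z.1 - (t - s) • z.2, z.2) -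
            Real.exp (-J' s) * G' s (z.1 - (t - s) • z.2, z.2)| :=
          mul_le_mul_of_nonneg_left (abs_integral_le_integral_abs ht.1) hw0.le
      _ = ∫ s in (0:ℝ)..t, (1 + ‖z‖) ^ K * |Real.exp (-J s) * G s (z.1 - (t - s) • z.2, z.2) -
            Real.exp (-J' s) * G' s (z.1 - (t - s) • z.2, z.2)| := (intervalIntegral.integral_const_mul _ _).symm
      _ ≤ ∫ s in (0:ℝ)..t, (1 + T) ^ K * (dG s + DL * Γ'K) :=
          integral_mono_on ht.1 (((hc1.sub hc2).intervalIntegrable_of_Icc ht.1).abs.const_mul _)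
            (((hdGi.add intervalIntegrable_const)).const_mul _) fun s hs => h2 s hs
      _ = (1 + T) ^ K * ((∫ s in (0:ℝ)..t, dG s) + DL * Γ'K * t) := by
          rw [intervalIntegral.integral_const_mul, integral_add hdGi intervalIntegrable_const,
            intervalIntegral.integral_const, smul_eq_mul, sub_zero]
          ring
  -- assemble
  have hUU' : U t z - U' t z = (f₀ (z.1 - t • z.2, z.2) * Real.exp (-J 0) - f₀ (z.1 - t • z.2, z.2) * Real.exp (-J' 0)) +
      ((∫ s in (0:ℝ)..t, Real.exp (-J s) * G s (z.1 - (t - s) • z.2, z.2)) -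
        ∫ s in (0:ℝ)..t, Real.exp (-J' s) * G' s (z.1 - (t - s) • z.2, z.2)) := by
    rw [hU t ht z, hU' t ht z]
    simp only [hJdef, hJ'def]
    ring
  rw [hUU']
  calc (1 + ‖z‖) ^ K * |(f₀ (z.1 - t • z.2, z.2) * Real.exp (-J 0) - f₀ (z.1 - t • z.2, z.2) * Real.exp (-J' 0)) +
        ((∫ s in (0:ℝ)..t, Real.exp (-J s) * G s (z.1 - (t - s) • z.2, z.2)) -
          ∫ s in (0:ℝ)..t, Real.exp (-J' s) * G' s (z.1 - (t - s) • z.2, z.2))|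
      ≤ (1 + T) ^ K * Φ * DL + (1 + T) ^ K * ((∫ s in (0:ℝ)..t, dG s) + DL * Γ'K * t) := by
        rw [← sub_nonneg]
        have := abs_add_le (f₀ (z.1 - t • z.2, z.2) * Real.exp (-J 0) - f₀ (z.1 - t • z.2, z.2) * Real.exp (-J' 0))
          ((∫ s in (0:ℝ)..t, Real.exp (-J s) * G s (z.1 - (t - s) • z.2, z.2)) -
            ∫ s in (0:ℝ)..t, Real.exp (-J' s) * G' s (z.1 - (t - s) • z.2, z.2))
        nlinarith [h1, hI, mul_le_mul_of_nonneg_left this hw0.le]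
    _ ≤ (1 + T) ^ K * ((Φ + Γ'K * T) * DL + ∫ s in (0:ℝ)..t, dG s) := by
        have hΓ : DL * Γ'K * t ≤ DL * Γ'K * T := mul_le_mul_of_nonneg_left ht.2 (mul_nonneg hDL0 hΓ0)
        nlinarith [hΓ, pow_nonneg (by linarith : (0:ℝ) ≤ 1 + T) K]

/-- **All weighted slice derivatives of the Duhamel formula are bounded uniformly on `[0, T]`**
(the level-`n` estimate with constant majorants, and the level-zero bound). [folklore] -/
theorem duhamel_slice_bounds (hf₀ : ContDiff ℝ ∞ f₀)
    (hf₀b : ∀ n k : ℕ, ∃ C : ℝ, ∀ y : E × E, (1 + ‖y‖) ^ k * ‖iteratedFDeriv ℝ n f₀ y‖ ≤ C)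
    (hL : ∀ σ, ContDiff ℝ ∞ (L σ)) (hLc : ∀ y, ContinuousOn (fun σ => L σ y) (Icc 0 T))
    (hLb : ∀ n : ℕ, ∃ C : ℝ, ∀ σ ∈ Icc (0:ℝ) T, ∀ y, ‖iteratedFDeriv ℝ n (L σ) y‖ ≤ C)
    (hL0 : ∀ σ ∈ Icc (0:ℝ) T, ∀ y, 0 ≤ L σ y)
    (hG : ∀ s, ContDiff ℝ ∞ (G s)) (hGc : ∀ y, ContinuousOn (fun s => G s y) (Icc 0 T))
    (hGb : ∀ n k : ℕ, ∃ C : ℝ, ∀ s ∈ Icc (0:ℝ) T, ∀ y : E × E,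
      (1 + ‖y‖) ^ k * ‖iteratedFDeriv ℝ n (G s) y‖ ≤ C)
    (hU : ∀ t ∈ Icc (0:ℝ) T, ∀ z : E × E, U t z =
      f₀ (z.1 - t • z.2, z.2) * Real.exp (-(∫ σ in (0:ℝ)..t, L σ (z.1 - (t - σ) • z.2, z.2))) +
        ∫ s in (0:ℝ)..t, Real.exp (-(∫ σ in s..t, L σ (z.1 - (t - σ) • z.2, z.2))) *
          G s (z.1 - (t - s) • z.2, z.2))
    (hT : 0 ≤ T) (n k : ℕ) :
    ∃ C : ℝ, ∀ t ∈ Icc (0:ℝ) T, ∀ z : E × E, (1 + ‖z‖) ^ k * ‖iteratedFDeriv ℝ n (U t) z‖ ≤ C := by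
  choose CF hCF using hf₀b
  choose CL hCL using hLb
  choose CG hCG using hGb
  rcases Nat.eq_zero_or_pos n with hn | hn
  · subst hn
    have hΦ : ∀ y : E × E, (1 + ‖y‖) ^ k * |f₀ y| ≤ CF 0 k := fun y => by
      have := hCF 0 k y; rwa [norm_iteratedFDeriv_zero, Real.norm_eq_abs] at this
    have hγ : ∀ s ∈ Icc (0:ℝ) T, ∀ y : E × E, (1 + ‖y‖) ^ k * |G s y| ≤ CG 0 k := fun s hs y => by
      have := hCG 0 k s hs y; rwa [norm_iteratedFDeriv_zero, Real.norm_eq_abs] at this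
    refine ⟨(1 + T) ^ k * (CF 0 k + T * |CG 0 k|), fun t ht z => ?_⟩
    rw [norm_iteratedFDeriv_zero, Real.norm_eq_abs]
    refine (duhamel_slice_weight_bound_zero hL hLc (fun m => ⟨CL m, hCL m⟩) hL0 hG hGc (fun m k' => ⟨CG m k', hCG m k'⟩)
      hU hΦ (γ := fun _ => |CG 0 k|) continuousOn_const (fun s hs y => (hγ s hs y).trans (le_abs_self _)) ht z).trans ?_
    rw [intervalIntegral.integral_const, smul_eq_mul, sub_zero]
    refine mul_le_mul_of_nonneg_left (add_le_add le_rfl ?_) (by positivity)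
    exact mul_le_mul_of_nonneg_right ht.2 (abs_nonneg _)
  · set Λlow : ℝ := ∑ i ∈ Finset.range n, |CL i|
    set Glow : ℝ := ∑ i ∈ Finset.range n, |CG i k|
    set Φlow : ℝ := ∑ i ∈ Finset.range n, |CF i k|
    have hsum : ∀ {c : ℕ → ℝ} {i : ℕ}, i < n → c i ≤ ∑ j ∈ Finset.range n, |c j| := fun {c} {i} hi =>
      (le_abs_self _).trans (Finset.single_le_sum (f := fun j => |c j|) (fun j _ => abs_nonneg _) (Finset.mem_range.2 hi))
    obtain ⟨c₀, c₁, -, hc₁, hc⟩ := duhamel_slice_level_bound (E := E) hT hn k (Λlow := Λlow) (Glow := Glow) (Φlow := Φlow)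
      (Φtop := |CF n k|) (Finset.sum_nonneg fun _ _ => abs_nonneg _) (Finset.sum_nonneg fun _ _ => abs_nonneg _)
      (Finset.sum_nonneg fun _ _ => abs_nonneg _) (abs_nonneg _)
    refine ⟨c₀ + c₁ * (T * (|CL n| + |CG n k|)), fun t ht z => ?_⟩
    have h := hc f₀ L G U (fun _ => |CL n|) (fun _ => |CG n k|) hf₀ (fun i hi y => (hCF i k y).trans (hsum (c := fun j => CF j k) hi))
      (fun y => (hCF n k y).trans (le_abs_self _)) hL hLc (fun m => ⟨CL m, hCL m⟩) hL0
      (fun i hi σ hσ y => (hCL i σ hσ y).trans (hsum (c := CL) hi)) continuousOn_const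
      (fun σ hσ y => (hCL n σ hσ y).trans (le_abs_self _)) hG hGc (fun m k' => ⟨CG m k', hCG m k'⟩)
      (fun i hi s hs y => (hCG i k s hs y).trans (hsum (c := fun j => CG j k) hi)) continuousOn_const
      (fun s hs y => (hCG n k s hs y).trans (le_abs_self _)) hU t ht z
    refine h.trans (add_le_add le_rfl (mul_le_mul_of_nonneg_left ?_ hc₁))
    rw [intervalIntegral.integral_const, smul_eq_mul, sub_zero]
    exact mul_le_mul_of_nonneg_right ht.2 (by positivity)

end Time

end Literature.MathematicalPhysics.KineticTheory

end
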